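import Summits.BirchSwinnertonDyer.Rank1Residual.Additive.LevelToLayerZero
import Summits.BirchSwinnertonDyer.Rank1Residual.Additive.LocalTowerKernelCardEqTamagawa
import Literature.NumberTheory.EllipticCurves.LocalKummerSequenceSurjective
import HarnessLib

/-!
# The local indices of the tower Selmer structure: **`[θ_v⁻¹(𝒦_{v,0}) : 𝓚_v] = #𝒦_{v,0}[p^∞] =
# p^{ord_p c_v}`** once `p^m` kills `𝒦_{v,0}[p^∞]` — brick B4 ENTERING the count (C) at finite level
# through the factors `[𝓖_ℓ : 𝓚_ℓ]` (cell `b2b-bsdres`, CLASS-CLOSURE lane, class O10 — x1b GEN 38,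
# class lead; file 75 of the series)

HONEST FRAMING (cell `b2b-bsdres`, run/shared/lean/b2b/bsd-rank1-residual/, verbatim in every
file): the goal of the cell is to DELETE the COMBINATION-SHAPED residual classes of the
Birch–Swinnerton-Dyer formula for ALL analytic-rank `≤ 1` elliptic curves over `ℚ` — "full BSD
formula for every rank `≤ 1` curve in class `C`" assembled STRICTLY from published theorems — so
that the rank-`≤ 1` remainder becomes exactly the CONSTRUCTION-SHAPED classes, which are TYPED
(missing-input `Prop`s), NOT attempted. This is not "finishing BSD". CLASS-CLOSURE lane: prove
what is provable now; shrink each hard class to its core with data; no claim beyond stated classes;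
research routes on CONSTRUCTION-SHAPED X12 / O10; census / instrument output = EVIDENCE / conjecture
items, NEVER a Literature fact; `RESIDUAL-MAP.md` marks change only by signed lines. THIS FILE:
TOOL THEOREMS ONLY — no definition, no named Literature fact, no Summits-side fact `def … : Prop`,
no `sorry`, axioms standard; nothing is booked; no label / mark / count / sub-cell moves; (C1_η),
(C2_η-GZ), (C3_η) stay typed as filed (cc-typer-6's pen); O10 stays OPEN / CONSTRUCTION-SHAPED;
nothing about `BSD(W, p)` of any pair is claimed.

## What (all kernel theorems; `θ_v = resH1Hom (subgroupIncl H_{v,0}) id ∘ (E[p^m] → E(K̄_v))_*`)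

The count (C) at finite level (files 63, 68–70) has right-hand side
`#(p^t·C) · ∏_{ℓ ∈ T} [𝓖_ℓ : 𝓚_ℓ]`; for the tower structure `𝓖_ℓ = 𝓣_ℓ = θ_ℓ⁻¹(𝒦_{ℓ,0})` (files
71–74) the factors are computed here:
* §1 (groups) `relIndex_ker_comap_eq_natCard_inf_range`: `[f⁻¹(B) : ker f] = #(B ∩ im f)`.
* §2 `ker θ_v = 𝓚_v` and `im θ_v =` the `p^m`-torsion (the local Kummer sequence is exact on the
  right: `range_map_torsionPointsMapIntertwining`; `res` to `H_{v,0} ⊇ Γ_{K_v}` is bijective), so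
  **`[θ_v⁻¹(𝒦_{v,0}) : 𝓚_v] = #(𝒦_{v,0} ∩ H¹[p^m]) = #𝒦_{v,0}[p^∞]`** as soon as `p^m · 𝒦_{v,0}[p^∞] = 0`
  (`relIndex_kummer_comap_localTowerKer_eq_natCard_primary`), e.g. when `#𝒦_{v,0}[p^∞] ∣ p^m`.
* §3 with B4 (`natCard_localTowerKerPrimary_zero_eq_pow_padicValNat_localTamagawaNumber`, file 53): at a
  finite place `v ∤ p` NOT splitting completely in `K_∞/K` and `m ≥ ord_p c_v`:
  **`[θ_v⁻¹(𝒦_{v,0}) : 𝓚_v] = p^{ord_p c_v}`** — Greenberg's `|ker r_v| = c_v^{(p)}` as the local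
  factor of (C).

References: [GreenbergLNM1716] §3 Lemma 3.3 (pp. 86–88), §4 p. 74; [SilvermanAEC2009] X.§4 (**);
[MilneADT2006] I §3, §6.
-/

noncomputable section

open scoped Classical

open WeierstrassCurve Literature.NumberTheory.EllipticCurves Literature.NumberTheory.GaloisRepresentations
  NumberField IsDedekindDomain Field
open scoped ContRepresentation

namespace Summit.BirchSwinnertonDyer.Rank1Residual.Additive.LevelBridge

universe u

/-! ### §1 `[f⁻¹(B) : ker f] = #(B ∩ im f)` -/

section Group

variable {G H : Type*} [AddCommGroup G] [AddCommGroup H]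

/-- **`[f⁻¹(B) : ker f] = #(B ∩ im f)`** for a homomorphism `f : G → H` and `B ≤ H`
(`f⁻¹(B) ⧸ ker f ≅ B ∩ im f`; Mathlib `relIndex_comap`, `map_comap_eq`, `relIndex_bot_left`).
[folklore] -/
theorem relIndex_ker_comap_eq_natCard_inf_range (f : G →+ H) (B : AddSubgroup H) :
    f.ker.relIndex (B.comap f) = Nat.card ↥(B ⊓ f.range) := by
  rw [← AddMonoidHom.comap_bot, AddSubgroup.relIndex_comap, AddSubgroup.map_comap_eq,
    AddSubgroup.relIndex_bot_left, inf_comm]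

/-- In a finite group of order dividing `N`, `N` kills every element. [folklore] -/
theorem nsmul_eq_zero_of_natCard_dvd {A : Type*} [AddCommGroup A] {N : ℕ} (hA : Nat.card A ∣ N)
    (x : A) : N • x = 0 :=
  addOrderOf_dvd_iff_nsmul_eq_zero.mp ((addOrderOf_dvd_natCard x).trans hA)

end Group

/-! ### §2 `ker θ_v = 𝓚_v`, `im θ_v = H¹[p^m]`, and the index of the tower condition -/

section Local

variable {K : Type u} [Field K] (W : WeierstrassCurve K) (p : ℕ) [hp : Fact p.Prime]
  (κ : ZpExtension K p) (m : ℕ) (E : Type u) [Field E] [Algebra K E]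

/-- **`ker θ_E = 𝓚_E`**: the kernel of `θ_E = res_{H_{E,0}} ∘ (E[p^m] → E(K̄_E))_*` is the local Kummer
condition (restriction to `H_{E,0} ⊇ Γ_E` is injective; file 71). [cite: SilvermanAEC2009, X.§4 (definition of the m-Selmer group)] -/
theorem ker_resH1Hom_comp_map_eq_kummerLocalConditionAt :
    ((resH1Hom (Literature.NumberTheory.EllipticCurves.subgroupIncl (localSubgroup (κ.layerSubgroup 0) E))
        (AddMonoidHom.id (localPoints W E)) (fun _ _ ↦ rfl)).comp
        (galoisCohomology.map (W.torsionPointsMapIntertwining ((p ^ m : ℕ) : ℤ) E) 1)).ker =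
      W.kummerLocalConditionAt ((p ^ m : ℕ) : ℤ) E := by
  ext x
  rw [AddMonoidHom.mem_ker, AddMonoidHom.comp_apply]
  exact ⟨mem_kummerLocalConditionAt_of_resH1Hom_map_eq_zero W p κ m E,
    resH1Hom_map_eq_zero_of_mem_kummerLocalConditionAt W p κ m E⟩

/-- **`B ∩ im θ_E = B[p^m]`** for every `B ≤ H¹(H_{E,0}, E(K̄_E))` (`W` elliptic, `char K = 0`): the
image of `(E[p^m] → E(K̄_E))_*` is exactly the `p^m`-torsion (`range_map_torsionPointsMapIntertwining`)
and `res_{H_{E,0}}` is a bijection commuting with `p^m`. [cite: SilvermanAEC2009, X.§4 diagram (**)] -/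
theorem mem_inf_range_iff [CharZero K] [W.IsElliptic]
    (B : AddSubgroup (discreteH1 (localSubgroup (κ.layerSubgroup 0) E) (localPoints W E)))
    (x : discreteH1 (localSubgroup (κ.layerSubgroup 0) E) (localPoints W E)) :
    x ∈ B ⊓ ((resH1Hom (Literature.NumberTheory.EllipticCurves.subgroupIncl (localSubgroup (κ.layerSubgroup 0) E))
        (AddMonoidHom.id (localPoints W E)) (fun _ _ ↦ rfl)).comp
        (galoisCohomology.map (W.torsionPointsMapIntertwining ((p ^ m : ℕ) : ℤ) E) 1)).range ↔
      x ∈ B ∧ p ^ m • x = 0 := by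
  haveI : CharZero E := charZero_of_injective_algebraMap (algebraMap K E).injective
  have hne : ((p ^ m : ℕ) : ℤ) ≠ 0 := by exact_mod_cast pow_ne_zero m hp.out.ne_zero
  have hbij := bijective_resH1Hom_subgroupIncl (localPoints W E)
    (localSubgroup (κ.layerSubgroup 0) E) (mem_localSubgroup_layerSubgroup_zero p κ E)
  rw [AddSubgroup.mem_inf, AddMonoidHom.mem_range]
  refine and_congr Iff.rfl ⟨?_, fun hx ↦ ?_⟩
  · rintro ⟨y, rfl⟩
    rw [← map_nsmul, pow_smul_galoisCohomology_restrictField_torsion_eq_zero, map_zero]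
  · obtain ⟨y, rfl⟩ := hbij.2 x
    have hy : ((p ^ m : ℕ) : ℤ) • y = 0 := by
      apply hbij.1
      rw [map_zsmul, natCast_zsmul, hx, map_zero]
    obtain ⟨z, hz⟩ := (W.mem_range_map_torsionPointsMapIntertwining_iff E hne y).mpr hy
    exact ⟨z, (AddMonoidHom.comp_apply _ _ z).trans (congrArg _ hz)⟩

/-- **`[θ_E⁻¹(𝒦_{E,0}) : 𝓚_E] = #𝒦_{E,0}[p^∞]` once `p^m · 𝒦_{E,0}[p^∞] = 0`** (`W` elliptic,
`char K = 0`): the index of the Kummer condition in the tower condition at level `m` is the order of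
the `p`-power torsion of the local tower kernel — the factor `[𝓖_ℓ : 𝓚_ℓ]` of the count (C) at finite
level for the tower structure. [cite: GreenbergLNM1716, §3 Lemma 3.3 (pp. 86–88)] -/
theorem relIndex_kummer_comap_localTowerKer_eq_natCard_primary [CharZero K] [W.IsElliptic]
    (hm : ∀ x ∈ W.localTowerKerPrimary κ E 0, p ^ m • x = 0) :
    (W.kummerLocalConditionAt ((p ^ m : ℕ) : ℤ) E).relIndex
        ((W.localTowerKer κ E 0).comap
          ((resH1Hom (Literature.NumberTheory.EllipticCurves.subgroupIncl (localSubgroup (κ.layerSubgroup 0) E))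
            (AddMonoidHom.id (localPoints W E)) (fun _ _ ↦ rfl)).comp
            (galoisCohomology.map (W.torsionPointsMapIntertwining ((p ^ m : ℕ) : ℤ) E) 1))) =
      Nat.card (W.localTowerKerPrimary κ E 0) := by
  rw [← ker_resH1Hom_comp_map_eq_kummerLocalConditionAt W p κ m E,
    relIndex_ker_comap_eq_natCard_inf_range]
  congr 1
  apply congrArg (fun S : AddSubgroup _ ↦ (↥S : Type u))
  ext x
  rw [mem_inf_range_iff, mem_localTowerKerPrimary_iff]
  exact ⟨fun ⟨hx, h⟩ ↦ ⟨hx, m, h⟩, fun ⟨hx, _⟩ ↦ ⟨hx, hm x ⟨hx, ‹_›⟩⟩⟩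

/-- The same with the hypothesis in the form **`#𝒦_{E,0}[p^∞] ∣ p^m`**. [cite: GreenbergLNM1716, §3 Lemma 3.3 (pp. 86–88)] -/
theorem relIndex_kummer_comap_localTowerKer_eq_natCard_primary_of_dvd [CharZero K] [W.IsElliptic]
    (hm : Nat.card (W.localTowerKerPrimary κ E 0) ∣ p ^ m) :
    (W.kummerLocalConditionAt ((p ^ m : ℕ) : ℤ) E).relIndex
        ((W.localTowerKer κ E 0).comap
          ((resH1Hom (Literature.NumberTheory.EllipticCurves.subgroupIncl (localSubgroup (κ.layerSubgroup 0) E))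
            (AddMonoidHom.id (localPoints W E)) (fun _ _ ↦ rfl)).comp
            (galoisCohomology.map (W.torsionPointsMapIntertwining ((p ^ m : ℕ) : ℤ) E) 1))) =
      Nat.card (W.localTowerKerPrimary κ E 0) :=
  relIndex_kummer_comap_localTowerKer_eq_natCard_primary W p κ m E fun x hx ↦ by
    have h := nsmul_eq_zero_of_natCard_dvd hm (⟨x, hx⟩ : W.localTowerKerPrimary κ E 0)
    exact congrArg Subtype.val h

end Local

/-! ### §3 At a non-split `v ∤ p`: the local factor is `p^{ord_p c_v}` (B4) -/

section Tamagawa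

variable {K : Type u} [Field K] [NumberField K] (W : WeierstrassCurve K) [W.IsElliptic] (p : ℕ)
  [hp : Fact p.Prime] (κ : ZpExtension K p) (m : ℕ) {v : HeightOneSpectrum (𝓞 K)}

/-- **The local factor of (C) at a non-split `v ∤ p`: `[θ_v⁻¹(𝒦_{v,0}) : 𝓚_v] = p^{ord_p c_v}`** for
`m ≥ ord_p c_v`, `c_v` the local Tamagawa number of `W/K_v` (B4, file 53:
`#𝒦_{v,0}[p^∞] = p^{ord_p c_v}` at every finite place `v ∤ p` that does not split completely in
`K_∞/K`, any `ℤ_p`-extension, any reduction type; + §2). In the count (C) at finite level (files 63,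
68–70) with the tower structure `𝓖_ℓ = θ_ℓ⁻¹(𝒦_{ℓ,0})` this is the factor `[𝓖_ℓ : 𝓚_ℓ] = c_ℓ^{(p)}`,
so `∏_{ℓ ∈ T} [𝓖_ℓ : 𝓚_ℓ] = Tam(W)^{(p)}` for `T ⊇` the bad places `≠ v₀`.
[cite: GreenbergLNM1716, §3 Lemma 3.3 (pp. 86–88) and §4 p. 74] -/
theorem relIndex_kummer_comap_localTowerKer_eq_pow_padicValNat_localTamagawaNumber
    (hpv : (p : 𝓞 K) ∉ v.asIdeal)
    (hns : ∃ δ : absoluteGaloisGroup (v.adicCompletion K),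
      resGal (K := K) (v.adicCompletion K) δ ∉ κ.kerSubgroup)
    (hm : padicValNat p ((W.baseChange (v.adicCompletion K)).localTamagawaNumber
      (v.adicCompletionIntegers K)) ≤ m) :
    (W.kummerLocalConditionAt ((p ^ m : ℕ) : ℤ) (v.adicCompletion K)).relIndex
        ((W.localTowerKer κ (v.adicCompletion K) 0).comap
          ((resH1Hom (Literature.NumberTheory.EllipticCurves.subgroupIncl (localSubgroup (κ.layerSubgroup 0) (v.adicCompletion K)))
            (AddMonoidHom.id (localPoints W (v.adicCompletion K))) (fun _ _ ↦ rfl)).comp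
            (galoisCohomology.map
              (W.torsionPointsMapIntertwining ((p ^ m : ℕ) : ℤ) (v.adicCompletion K)) 1))) =
      p ^ padicValNat p ((W.baseChange (v.adicCompletion K)).localTamagawaNumber
        (v.adicCompletionIntegers K)) := by
  haveI : CharZero (v.adicCompletion K) :=
    charZero_of_injective_algebraMap (algebraMap K (v.adicCompletion K)).injective
  have hcard := natCard_localTowerKerPrimary_zero_eq_pow_padicValNat_localTamagawaNumber W κ hpv hns
  rw [relIndex_kummer_comap_localTowerKer_eq_natCard_primary_of_dvd W p κ m (v.adicCompletion K)
    (by rw [hcard]; exact pow_dvd_pow p hm), hcard]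

end Tamagawa

end Summit.BirchSwinnertonDyer.Rank1Residual.Additive.LevelBridge

end
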